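import Mathlib.Analysis.Complex.Basic
import Mathlib.Analysis.Calculus.FDeriv.Prod
import Mathlib.Analysis.Calculus.Deriv.Inv
import Mathlib.Analysis.Calculus.ContDiff.Defs
import HarnessLib

/-!
# Chart data of an almost complex structure on `ℂℙ¹ × ℂ` along a holomorphic zero section

Layer B4b/B6 interface of the analytic core of the Hofer–Lizan–Sikorav local foliation theorem
(Wendl 2018, Thm. 2.46 / Prop. 2.53; lead of crux `WitnessCharge`, summit `SmoothPoincare4`).
An almost complex structure on `ℂℙ¹ × ℂ` — concretely: on a product neighbourhood
`ι : ℂℙ¹ × ℂ ↪ X` of an embedded `J`-sphere with trivial normal bundle, read through the two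
product charts — is recorded by its two chart expressions `J₀, J₁ : ℂ × ℂ → End_ℝ(ℂ × ℂ)` in the
coordinates `(Z, t)` and `(W, t)`, `W = Z⁻¹`: smooth, squaring to `-1`, related by the chart
change `psi (Z, t) = (Z⁻¹, t)` (`compat`), and mapping the axis vector `(ζ, 0)` to `(I ζ, 0)`
along `t = 0` (the zero section with its chart parametrisations is `J`-holomorphic and its
tangent line `J`-invariant) — the structure `SphereACData`. We record the block form along the
zero section: `J₀ (Z, 0) (ζ, t) = (I ζ + B₀ t, D₀ t)` with `D₀ = nrm₀ Z` a complex structure on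
the normal plane (`nrm₀_sq`), and `nrm₁ W = nrm₀ W⁻¹` on the overlap (`nrm₁_eq`).
The Cauchy–Riemann operator built on these data is in `SphereCROperatorPointwise.lean`.

## References

* C. Wendl, *Holomorphic Curves in Low Dimensions*, LNM 2216 (2018), §2.3, Thm. 2.46. [Wendl2018]
-/

noncomputable section

open Complex Set Filter
open scoped Topology ContDiff

namespace Literature.Geometry.Symplectic

namespace SphereCR

/-! ### The chart change `psi (Z, t) = (Z⁻¹, t)` and its differential -/

/-- The chart change of `ℂℙ¹ × ℂ` between the two product charts: `(Z, t) ↦ (Z⁻¹, t)`.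
[folklore] -/
def psi (x : ℂ × ℂ) : ℂ × ℂ := (x.1⁻¹, x.2)

/-- The differential of `psi` at `x` (for `x.1 ≠ 0`): `(a, b) ↦ (-x.1⁻² a, b)`. [folklore] -/
def dPsi (x : ℂ × ℂ) : ℂ × ℂ →L[ℝ] ℂ × ℂ :=
  (((-(x.1 ^ 2)⁻¹) • ContinuousLinearMap.id ℂ ℂ).restrictScalars ℝ).prodMap
    (ContinuousLinearMap.id ℝ ℂ)

/-- Pointwise formula for `dPsi`. [folklore] -/
@[simp] theorem dPsi_apply (x v : ℂ × ℂ) : dPsi x v = (-(x.1 ^ 2)⁻¹ * v.1, v.2) := by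
  simp [dPsi, Prod.map, neg_mul]

/-- `psi` has differential `dPsi x` at `x` when `x.1 ≠ 0`. [folklore] -/
theorem hasFDerivAt_psi {x : ℂ × ℂ} (hx : x.1 ≠ 0) : HasFDerivAt psi (dPsi x) x := by
  have h1 := ((hasDerivAt_inv hx).hasFDerivAt.restrictScalars ℝ).comp x
    (hasFDerivAt_fst (𝕜 := ℝ) (E := ℂ) (F := ℂ) (p := x))
  have h := h1.prodMk (hasFDerivAt_snd (𝕜 := ℝ) (E := ℂ) (F := ℂ) (p := x))
  refine h.congr_fderiv (ContinuousLinearMap.ext fun v => ?_)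
  refine Prod.ext ?_ ?_
  · simp [mul_comm]
  · simp

/-- `dPsi x` is complex-linear for the standard structure: it commutes with `I •`. [folklore] -/
theorem dPsi_smul_I (x v : ℂ × ℂ) : dPsi x (I • v) = I • dPsi x v := by
  ext <;> simp [mul_left_comm]

/-! ### Data: an almost complex structure on `ℂℙ¹ × ℂ` in the two product charts -/

/-- **Chart data of an almost complex structure on `ℂℙ¹ × ℂ` along which the zero section is a
holomorphically parametrised `J`-curve**: the two chart expressions, smooth, squaring to `-1`,
related by the chart change `psi`, and mapping the axis vector `(ζ, 0)` to `(I ζ, 0)` along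
`t = 0` (the zero section with its chart parametrisation is `J`-holomorphic and its tangent
line is `J`-invariant). [cite: Wendl2018, §2.3] -/
structure SphereACData where
  /-- the structure in the chart `(Z, t)` -/
  J₀ : ℂ × ℂ → ℂ × ℂ →L[ℝ] ℂ × ℂ
  /-- the structure in the chart `(W, t)`, `W = Z⁻¹` -/
  J₁ : ℂ × ℂ → ℂ × ℂ →L[ℝ] ℂ × ℂ
  smooth₀ : ContDiff ℝ ∞ J₀
  smooth₁ : ContDiff ℝ ∞ J₁
  sq₀ : ∀ x v, J₀ x (J₀ x v) = -v
  sq₁ : ∀ x v, J₁ x (J₁ x v) = -v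
  /-- `J₁ (psi x) ∘ dpsi_x = dpsi_x ∘ J₀ x` -/
  compat : ∀ x : ℂ × ℂ, x.1 ≠ 0 → ∀ v, J₁ (psi x) (dPsi x v) = dPsi x (J₀ x v)
  axis₀ : ∀ Z ζ : ℂ, J₀ (Z, 0) (ζ, 0) = (I * ζ, 0)
  axis₁ : ∀ W ζ : ℂ, J₁ (W, 0) (ζ, 0) = (I * ζ, 0)

namespace SphereACData

variable (𝒥 : SphereACData)

/-! ### The normal complex structure along the zero section and its normaliser -/

/-- The complex structure induced on the normal direction at the point `Z` of the zero section,
chart `0`: the `(2,2)` block of `J₀ (Z, 0)`. [cite: Wendl2018, §2.3] -/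
def nrm₀ (Z : ℂ) : ℂ →L[ℝ] ℂ :=
  (ContinuousLinearMap.snd ℝ ℂ ℂ).comp ((𝒥.J₀ (Z, 0)).comp (ContinuousLinearMap.inr ℝ ℂ ℂ))

/-- The same in chart `1`. [cite: Wendl2018, §2.3] -/
def nrm₁ (W : ℂ) : ℂ →L[ℝ] ℂ :=
  (ContinuousLinearMap.snd ℝ ℂ ℂ).comp ((𝒥.J₁ (W, 0)).comp (ContinuousLinearMap.inr ℝ ℂ ℂ))

/-- Pointwise formula for `nrm₀`. [folklore] -/
@[simp] theorem nrm₀_apply (Z t : ℂ) : 𝒥.nrm₀ Z t = (𝒥.J₀ (Z, 0) (0, t)).2 := rfl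
/-- Pointwise formula for `nrm₁`. [folklore] -/
@[simp] theorem nrm₁_apply (W t : ℂ) : 𝒥.nrm₁ W t = (𝒥.J₁ (W, 0) (0, t)).2 := rfl

/-- The off-diagonal block `B₀ (Z) t = (J₀ (Z,0) (0,t)).1`. [cite: Wendl2018, §2.3] -/
def off₀ (Z : ℂ) : ℂ →L[ℝ] ℂ :=
  (ContinuousLinearMap.fst ℝ ℂ ℂ).comp ((𝒥.J₀ (Z, 0)).comp (ContinuousLinearMap.inr ℝ ℂ ℂ))

/-- Pointwise formula for `off₀`. [folklore] -/
@[simp] theorem off₀_apply (Z t : ℂ) : 𝒥.off₀ Z t = (𝒥.J₀ (Z, 0) (0, t)).1 := rfl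

/-- Block description of `J₀` along the zero section: `J₀ (Z,0) (ζ, t) = (I ζ + B₀ t, D₀ t)`.
[cite: Wendl2018, §2.3] -/
theorem J₀_axis_apply (Z ζ t : ℂ) :
    𝒥.J₀ (Z, 0) (ζ, t) = (I * ζ + 𝒥.off₀ Z t, 𝒥.nrm₀ Z t) := by
  have h : ((ζ, t) : ℂ × ℂ) = (ζ, 0) + (0, t) := by simp
  conv_lhs => rw [h, map_add, 𝒥.axis₀]
  ext <;> simp

/-- The normal structure squares to `-1` (from `J₀² = -1` and the block form). [folklore] -/
theorem nrm₀_sq (Z t : ℂ) : 𝒥.nrm₀ Z (𝒥.nrm₀ Z t) = -t := by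
  have h := 𝒥.sq₀ (Z, 0) (0, t)
  rw [𝒥.J₀_axis_apply, 𝒥.J₀_axis_apply] at h
  simpa using congrArg Prod.snd h

/-- Block description of `J₁` along the zero section. [cite: Wendl2018, §2.3] -/
theorem J₁_axis_apply (W ζ t : ℂ) :
    𝒥.J₁ (W, 0) (ζ, t) = (I * ζ + (𝒥.J₁ (W, 0) (0, t)).1, 𝒥.nrm₁ W t) := by
  have h : ((ζ, t) : ℂ × ℂ) = (ζ, 0) + (0, t) := by simp
  conv_lhs => rw [h, map_add, 𝒥.axis₁]
  ext <;> simp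

/-- The normal structure squares to `-1`, chart `1`. [folklore] -/
theorem nrm₁_sq (W t : ℂ) : 𝒥.nrm₁ W (𝒥.nrm₁ W t) = -t := by
  have h := 𝒥.sq₁ (W, 0) (0, t)
  rw [← Prod.mk.eta (p := 𝒥.J₁ (W, 0) (0, t)), 𝒥.J₁_axis_apply] at h
  simpa using congrArg Prod.snd h

/-- **The two normal structures agree on the overlap**: `nrm₁ W = nrm₀ W⁻¹` (`W ≠ 0`), by the
compatibility with the chart change (whose differential is the identity on the `t`-factor).
[cite: Wendl2018, §2.3] -/
theorem nrm₁_eq (W : ℂ) (hW : W ≠ 0) : 𝒥.nrm₁ W = 𝒥.nrm₀ W⁻¹ := by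
  ext t
  have hx : ((W⁻¹, (0 : ℂ)) : ℂ × ℂ).1 ≠ 0 := inv_ne_zero hW
  have h := 𝒥.compat (W⁻¹, 0) hx (0, t)
  have hpsi : psi (W⁻¹, 0) = (W, 0) := by simp [psi]
  rw [hpsi, dPsi_apply, dPsi_apply] at h
  simp only [mul_zero] at h
  have h2 := congrArg Prod.snd h
  simp only at h2
  rw [nrm₁_apply, nrm₀_apply, h2]

end SphereACData

end SphereCR

end Literature.Geometry.Symplectic

end
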